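import Summits.Ventures.CertifiedQuantumChemistry.Rows.SingletRows
import Summits.Ventures.CertifiedQuantumChemistry.Rows.NSector
import Summits.Ventures.CertifiedQuantumChemistry.Hamiltonians.HubbardRingTV
import Literature.MathematicalPhysics.QuantumLattice.HubbardHalfFilledGroundState
import Literature.MathematicalPhysics.QuantumLattice.HubbardSpinReflectionSignRule
import HarnessLib

/-!
# Ventures/CertifiedQuantumChemistry — Rows/LiebSingletBridge.lean: singlet rows = sector rows on the half-filled even Hubbard rings (Lieb 1989)

HONEST FRAMING (verbatim): certified bounds for a stated model Hamiltonian in a stated basis; not a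
claim about the real molecule beyond that model.

Ruling LIT-L (lead gen 9, bench LIT-g9 option): the singlet-restricted lower rows (`e0S0[…]`,
`SingletLowerRow`, FORMAT-qcl1 + E3) on the TV-H Hubbard ring files bound
`Model.singletEnergy F n = E₀(H_F; N = 2n, S = 0)`, while the exact-vector upper rows #1–#10 bound the
sector quantity `Model.energy F n n = E₀(H_F; N_α = N_β = n)`; in general only
`energy n n ≤ singletEnergy n` holds (`Rows/SingletRows.lean`, SD-5) and the two are NEVER silently
identified. For the REPULSIVE Hubbard model at HALF FILLING on a CONNECTED BIPARTITE graph with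
`|A| = |B|`, Lieb's second theorem (E. H. Lieb, *Two theorems on the Hubbard model*, PRL 62 (1989)
1201, Thm 2) says the `N = |Λ|` ground state is unique and a singlet — and this is a TREE THEOREM:
`Literature.MathematicalPhysics.QuantumLattice.lieb_repulsive_halfFilling_holds`
(`HubbardWave0RepulsiveProofs`), specialised to `|A| = |B|` in `LiebHalfFilled.exists_unit_groundState`
(`HubbardHalfFilledGroundState`). So the bridge LIT-L asked for as "conditional on a named Literature
fact" is proved here UNCONDITIONALLY (no new fact, no hypothesis):

* §1 (generic, any model): a nonzero vector of the singlet subspace attaining the sector energy makes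
  `singletEnergy n = energy n n` (`Model.singletEnergy_eq_energy_of_singlet_witness`); row transport
  `SingletLowerRow → LowerRow`, `UpperRow → SingletUpperRow` under that equality.
* §2 (typer aside T-06, the instance fact LIT-L (b) wants PROVED, not assumed): the TV-H literal model
  IS the tree's graph Hubbard Hamiltonian on the `L`-ring,
  `(hubbardRingTV L t U).hamiltonian = hamiltonian (ringGraph L) t U` (`E_core = 0`, `h = −t` on
  ring bonds, `½ Σ_{στ} (pp|pp) a†a†aa = U n_{p↑} n_{p↓}`).
* §3: the `L`-ring is connected (`L ≥ 1`), and for even `L = 2n` bipartite with the even sites as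
  colour class `A`, `|Aᶜ| = |A|` (decidable instance facts, proved for every `n`).
* §4: `hubbardRingTV_singletEnergy_eq_energy`: for `L = 2n ≥ 2`, `t ≠ 0`, `U > 0`,
  `singletEnergy n = energy n n` on `hubbardRingTV (2n) t U`; hence every refereed singlet-restricted
  L on the ten TV-H files (`U/t ∈ {1, 10, 10², 10³, 10⁴} > 0`, `t = 1`, `L = 4, 6`, half filling)
  bounds the SAME number as the sector U's #1–#10 (`liebBracket_of_certificates`; instances in
  `Certificates/HubbardRingLiebBrackets.lean`).

What is NOT claimed (LIT-L (d)): nothing here applies to the molecular files (N₂, H-chains): no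
theorem places their sector ground states in `S = 0`; nothing applies away from half filling, for
`U ≤ 0`, odd `L`, or `t = 0`.

References: E. H. Lieb, PRL 62 (1989) 1201–1204 (Erratum 62, 1927), Theorem 2 [LiebPRL1989];
H. Tasaki, *Physics and Mathematics of Quantum Many-Body Systems* (2020) §10.2 [Tasaki2020].
Typer `pub-qchem-typer` (gen 2), 0 core-h.
-/

noncomputable section

namespace Summit.Ventures.CertifiedQuantumChemistry

open Matrix Finset
open Literature.MathematicalPhysics.QuantumLattice Literature.MathematicalPhysics.QuantumChemistry
open Summit.Ventures.CertifiedQuantumChemistry.Hamiltonians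
open scoped ComplexOrder

variable {k : ℕ}

/-! ## §1 Generic: a singlet witness of the sector energy identifies the two quantities -/

/-- If a NONZERO vector of the singlet subspace of the `2n`-electron sector has Rayleigh quotient at
most the sector energy `E₀(N_α = N_β = n)`, then the singlet quantity equals the sector quantity:
`E₀(N = 2n, S = 0) = E₀(N_α = N_β = n)` (Rayleigh–Ritz on the singlet subspace + `energy ≤ singletEnergy`). -/
theorem Model.singletEnergy_eq_energy_of_singlet_witness {F : Model k} (hF : F.IsSymmetric) {n : ℕ}
    (hn : n ≤ k) {ψ : Fock (Orb (Fin k))} (hψ : ψ ∈ singletSector k n) (h0 : ψ ≠ 0)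
    (hray : (star ψ ⬝ᵥ F.hamiltonian *ᵥ ψ).re ≤ F.energy n n * (star ψ ⬝ᵥ ψ).re) :
    F.singletEnergy n = F.energy n n := by
  refine le_antisymm ?_ (Model.energy_le_singletEnergy hF hn)
  have hpos : 0 < (star ψ ⬝ᵥ ψ).re := by
    have h1 : 0 < star ψ ⬝ᵥ ψ :=
      lt_of_le_of_ne (dotProduct_star_self_nonneg ψ) (Ne.symm (mt dotProduct_star_self_eq_zero.1 h0))
    exact (Complex.pos_iff.1 h1).1
  exact le_of_mul_le_mul_right
    ((minEnergyOn_mul_le_re_rayleigh (Model.hamiltonian_isHermitian hF) _ hψ).trans hray) hpos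

/-- Eigenvector form of the witness: a nonzero singlet eigenvector of `H_F` AT the sector energy. -/
theorem Model.singletEnergy_eq_energy_of_singlet_eigenvector {F : Model k} (hF : F.IsSymmetric)
    {n : ℕ} (hn : n ≤ k) {ψ : Fock (Orb (Fin k))} (hψ : ψ ∈ singletSector k n) (h0 : ψ ≠ 0)
    (hH : F.hamiltonian *ᵥ ψ = ((F.energy n n : ℝ) : ℂ) • ψ) :
    F.singletEnergy n = F.energy n n :=
  Model.singletEnergy_eq_energy_of_singlet_witness hF hn hψ h0
    (by rw [hH, dotProduct_smul, smul_eq_mul, Complex.re_ofReal_mul])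

/-- Row transport under the identification: a singlet lower row IS a sector lower row. -/
theorem SingletLowerRow.lowerRow_of_eq {F : Model k} {n : ℕ} {lo : ℚ} (h : SingletLowerRow F n lo)
    (heq : F.singletEnergy n = F.energy n n) : LowerRow F n n lo :=
  ⟨h.range, h.range, heq ▸ h.le⟩

/-- Row transport under the identification: a sector upper row IS a singlet upper row. -/
theorem UpperRow.singletUpperRow_of_eq {F : Model k} {n : ℕ} {hi : ℚ} (h : UpperRow F n n hi)
    (heq : F.singletEnergy n = F.energy n n) : SingletUpperRow F n hi :=
  ⟨h.range.1, heq ▸ h.le⟩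

/-- Under the identification, one SINGLET lower certificate and one SECTOR upper certificate give a
two-sided SECTOR row (and, by `Bracket.groundEnergy_mem`, a bracket of the `2n`-electron ground energy). -/
theorem liebBracket_of_certificates {F : Model k} (hF : F.IsSymmetric) {n : ℕ} (hn : n ≤ k)
    {lo hi : ℚ} (hL : SingletLowerCertificate F n lo) (hU : UpperCertificate F n n hi)
    (heq : F.singletEnergy n = F.energy n n) : Bracket F n n lo hi :=
  ⟨(singletLowerRow_of_certificate hF hn hL).lowerRow_of_eq heq, upperRow_of_certificate hF hU⟩

/-- … and equally a two-sided SINGLET row. -/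
theorem liebSingletBracket_of_certificates {F : Model k} (hF : F.IsSymmetric) {n : ℕ} (hn : n ≤ k)
    {lo hi : ℚ} (hL : SingletLowerCertificate F n lo) (hU : UpperCertificate F n n hi)
    (heq : F.singletEnergy n = F.energy n n) : SingletBracket F n lo hi :=
  ⟨singletLowerRow_of_certificate hF hn hL, (upperRow_of_certificate hF hU).singletUpperRow_of_eq heq⟩

/-! ## §2 The TV-H literal model is the graph Hubbard Hamiltonian on the ring (typer aside T-06) -/

namespace Hamiltonians

/-- The `L`-ring as a simple graph on `Fin L` (adjacency `ringAdj`: `q ≡ p ± 1 (mod L)`, `p ≠ q`). -/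
def ringGraph (L : ℕ) : SimpleGraph (Fin L) where
  Adj := ringAdj L
  symm := ⟨fun _ _ h => ringAdj_comm.1 h⟩
  loopless := ⟨fun _ h => h.1 rfl⟩

/-- Unfolding the adjacency of `ringGraph`. -/
@[simp] theorem ringGraph_adj {L : ℕ} (p q : Fin L) : (ringGraph L).Adj p q ↔ ringAdj L p q := Iff.rfl

/-- Adjacency of `ringGraph` is decidable (it is `ringAdj`), as `hamiltonian G t U` requires. -/
instance (L : ℕ) : DecidableRel (ringGraph L).Adj :=
  fun p q => inferInstanceAs (Decidable (ringAdj L p q))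

/-- A triple Kronecker sum collapses: `Σ_{q,r,s} [p = q = r = s] f q r s = f p p p`. -/
private theorem sum_ite_eq_three {α M : Type*} [Fintype α] [DecidableEq α] [AddCommMonoid M]
    (p : α) (f : α → α → α → M) :
    (∑ q, ∑ r, ∑ s, if p = q ∧ q = r ∧ r = s then f q r s else 0) = f p p p := by
  have h1 : ∀ q, q ≠ p → (∑ r, ∑ s, if p = q ∧ q = r ∧ r = s then f q r s else 0) = 0 :=
    fun q hq => Finset.sum_eq_zero fun r _ => Finset.sum_eq_zero fun s _ => if_neg fun h => hq h.1.symm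
  rw [Finset.sum_eq_single_of_mem p (Finset.mem_univ _) (fun q _ hq => h1 q hq)]
  have h2 : ∀ r, r ≠ p → (∑ s, if p = p ∧ p = r ∧ r = s then f p r s else 0) = 0 :=
    fun r hr => Finset.sum_eq_zero fun s _ => if_neg fun h => hr h.2.1.symm
  rw [Finset.sum_eq_single_of_mem p (Finset.mem_univ _) (fun r _ hr => h2 r hr)]
  rw [Finset.sum_eq_single_of_mem p (Finset.mem_univ _) (fun s _ hs => if_neg fun h => hs h.2.2.symm),
    if_pos ⟨rfl, rfl, rfl⟩]

/-- The on-site two-electron excitation operator is twice the double occupancy: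
`e_pppp = Σ_{στ} a†_{pσ} a†_{pτ} a_{pτ} a_{pσ} = 2 n_{p↑} n_{p↓}` (`e_pppp = E_pp² − E_pp`,
`E_pp = n_{p↑} + n_{p↓}`, `n² = n`, `[n_{p↑}, n_{p↓}] = 0`). HJO (2000) (2.2.16). -/
theorem twoElectronExcitation_self {Λ : Type*} [LinearOrder Λ] [Fintype Λ] (p : Λ) :
    twoElectronExcitation p p p p = numberOp p 0 * numberOp p 1 + numberOp p 0 * numberOp p 1 := by
  rw [twoElectronExcitation_eq_mul_sub, if_pos rfl]
  have hE : singletExcitation p p = numberOp p 0 + numberOp p 1 := by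
    rw [singletExcitation, Fin.sum_univ_two]; rfl
  have e0 : numberOp p 0 * numberOp p 0 = (numberOp p 0 : Matrix (Finset (Orb Λ)) (Finset (Orb Λ)) ℂ) :=
    (numberAt_idempotent (orb p 0)).eq
  have e1 : numberOp p 1 * numberOp p 1 = (numberOp p 1 : Matrix (Finset (Orb Λ)) (Finset (Orb Λ)) ℂ) :=
    (numberAt_idempotent (orb p 1)).eq
  have ec : numberOp p 1 * numberOp p 0 = (numberOp p 0 * numberOp p 1 : Matrix (Finset (Orb Λ)) (Finset (Orb Λ)) ℂ) :=
    (numberAt_commute (orb p 1) (orb p 0)).eq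
  rw [hE, add_mul, mul_add, mul_add, e0, e1, ec]
  abel

/-- **T-06.** The TV-H literal model of the `L`-ring IS the tree's graph Hubbard Hamiltonian:
`H_F(hubbardRingTV L t U) = −t Σ_{⟨xy⟩,σ} c†_{xσ} c_{yσ} + U Σ_x n_{x↑} n_{x↓} = hamiltonian (ringGraph L) t U`. -/
theorem hubbardRingTV_hamiltonian_eq (L : ℕ) (t U : ℚ) :
    (hubbardRingTV L t U).hamiltonian = hamiltonian (ringGraph L) (t : ℝ) (U : ℝ) := by
  have h1 : ∀ p q : Fin L, ((hubbardRingTV L t U).h p q : ℂ) • singletExcitation p q =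
      -((t : ℝ) : ℂ) • ∑ σ : Fin 2,
        (if (ringGraph L).Adj p q then creation (orb p σ) * annihilation (orb q σ) else 0) := by
    intro p q
    change ((if ringAdj L p q then -t else 0 : ℚ) : ℂ) • _ = _
    by_cases hc : ringAdj L p q
    · simp only [hc, if_true, ringGraph_adj, Rat.cast_neg, Complex.ofReal_ratCast, singletExcitation]
    · simp only [hc, if_false, ringGraph_adj, Rat.cast_zero, zero_smul, Finset.sum_const_zero, smul_zero]
  have h2 : ∀ p q r s : Fin L, ((hubbardRingTV L t U).eri p q r s : ℂ) • twoElectronExcitation p q r s =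
      if p = q ∧ q = r ∧ r = s then (U : ℂ) • twoElectronExcitation p q r s else 0 := by
    intro p q r s
    change ((if p = q ∧ q = r ∧ r = s then U else 0 : ℚ) : ℂ) • _ = _
    split_ifs <;> simp
  have h3 : (∑ p : Fin L, ∑ q : Fin L, ∑ r : Fin L, ∑ s : Fin L,
      ((hubbardRingTV L t U).eri p q r s : ℂ) • twoElectronExcitation p q r s) =
      ∑ p : Fin L, (U : ℂ) • (numberOp p 0 * numberOp p 1 + numberOp p 0 * numberOp p 1) := by
    refine Finset.sum_congr rfl fun p _ => ?_
    simp only [h2]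
    rw [sum_ite_eq_three p (fun q r s => (U : ℂ) • twoElectronExcitation p q r s),
      twoElectronExcitation_self]
  unfold Model.hamiltonian molecularHamiltonian hamiltonian
  rw [h3]
  simp only [h1]
  have hcore : (((hubbardRingTV L t U).ecore : ℚ) : ℂ) = 0 := by
    change ((0 : ℚ) : ℂ) = 0
    exact Rat.cast_zero
  rw [hcore, zero_smul, add_zero]
  congr 1
  · simp only [Finset.smul_sum]
  · rw [Complex.ofReal_ratCast, ← Finset.smul_sum, smul_smul, Finset.sum_add_distrib, ← two_smul ℂ,
      smul_smul]
    congr 1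
    ring

end Hamiltonians

/-! ## §3 The ring graph: connected; for even `L` bipartite with balanced colour classes -/

namespace Hamiltonians

/-- The `L`-ring is connected (`L ≥ 1`): `0 ~ 1 ~ ⋯ ~ L−1`. -/
theorem ringGraph_connected {L : ℕ} (hL : 0 < L) : (ringGraph L).Connected := by
  haveI : Nonempty (Fin L) := ⟨⟨0, hL⟩⟩
  have key : ∀ (m : ℕ) (hm : m < L), (ringGraph L).Reachable ⟨0, hL⟩ ⟨m, hm⟩ := by
    intro m
    induction m with
    | zero => intro hm; exact SimpleGraph.Reachable.refl _
    | succ m ih =>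
      intro hm
      refine (ih (by omega)).trans (SimpleGraph.Adj.reachable ((ringGraph_adj _ _).2 ?_))
      exact ⟨fun h => by simp [Fin.ext_iff] at h, Or.inl (Nat.mod_eq_of_lt hm)⟩
  exact ⟨fun p q => (key p.val p.isLt).symm.trans (key q.val q.isLt)⟩

/-- The even sites of the `L`-ring (Lieb's colour class `A`). -/
def evenSites (L : ℕ) : Finset (Fin L) := Finset.univ.filter fun p => p.val % 2 = 0

/-- Membership in `evenSites`. -/
theorem mem_evenSites {L : ℕ} (p : Fin L) : p ∈ evenSites L ↔ p.val % 2 = 0 := by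
  simp [evenSites]

/-- For even `L = 2n` the ring is bipartite with colour class the even sites: every bond joins an
even and an odd site (including the bond `L−1 ~ 0`, since `L−1` is odd). -/
theorem evenSites_bipartite (n : ℕ) :
    ∀ x y : Fin (2 * n), (ringGraph (2 * n)).Adj x y → (x ∈ evenSites (2 * n) ↔ y ∉ evenSites (2 * n)) := by
  have key : ∀ a b : Fin (2 * n), (a.val + 1) % (2 * n) = b.val →
      (a.val % 2 = 0 ↔ ¬ b.val % 2 = 0) := by
    intro a b hab
    have ha := a.isLt
    by_cases hlt : a.val + 1 < 2 * n
    · rw [Nat.mod_eq_of_lt hlt] at hab; omega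
    · have heq : a.val + 1 = 2 * n := by omega
      rw [heq, Nat.mod_self] at hab; omega
  intro x y hxy
  rw [ringGraph_adj] at hxy
  obtain ⟨-, h | h⟩ := hxy
  · rw [mem_evenSites, mem_evenSites]; exact key x y h
  · rw [mem_evenSites, mem_evenSites]; have := key y x h; tauto

/-- For even `L = 2n` the two colour classes are balanced: `|Aᶜ| = |A|` (the reflection
`p ↦ L − 1 − p` swaps parities since `L − 1` is odd). -/
theorem card_compl_evenSites (n : ℕ) : (evenSites (2 * n))ᶜ.card = (evenSites (2 * n)).card := by
  have h : (evenSites (2 * n))ᶜ = (evenSites (2 * n)).map Fin.revPerm.toEmbedding := by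
    ext q
    rw [Finset.mem_compl, Finset.mem_map_equiv, Fin.revPerm_symm, Fin.revPerm_apply, mem_evenSites,
      mem_evenSites, Fin.val_rev]
    have hq := q.isLt
    omega
  rw [h, Finset.card_map]

end Hamiltonians

/-! ## §4 Lieb's theorem ⇒ the singlet quantity is the sector quantity on the half-filled even rings -/

/-- **Singlet = sector on the half-filled repulsive even Hubbard ring** (Lieb 1989, Thm 2, as the tree
theorem `LiebHalfFilled.exists_unit_groundState`): for `L = 2n ≥ 2`, `t ≠ 0`, `U > 0`,
`E₀(H_F; N = 2n, S = 0) = E₀(H_F; N_α = N_β = n)` for `F = hubbardRingTV (2n) t U` — the unique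
`2n`-electron ground state is a singlet of the central sector. -/
theorem hubbardRingTV_singletEnergy_eq_energy {n : ℕ} (hn : 0 < n) {t U : ℚ} (ht : t ≠ 0)
    (hU : 0 < U) :
    (hubbardRingTV (2 * n) t U).singletEnergy n = (hubbardRingTV (2 * n) t U).energy n n := by
  have hF := hubbardRingTV_isSymmetric (2 * n) t U
  have hnk : n ≤ 2 * n := by omega
  obtain ⟨ψ, hψK, hψ1, hHψ, hS, -, -⟩ := LiebHalfFilled.exists_unit_groundState
    (ringGraph_connected (by omega : 0 < 2 * n)) (evenSites (2 * n)) (evenSites_bipartite n)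
    (card_compl_evenSites n) (t := (t : ℝ)) (U := (U : ℝ)) (by exact_mod_cast ht) (by exact_mod_cast hU)
  rw [Fintype.card_fin] at hψK hHψ
  have h0 : ψ ≠ 0 := by
    intro h
    rw [h, dotProduct_zero] at hψ1
    exact zero_ne_one hψ1
  obtain ⟨hP, -, -⟩ := spin_mulVec_eq_zero_of_spinSq_mulVec_eq_zero hS
  have h2n : n + n = 2 * n := by ring
  have hψS : ψ ∈ singletSector (2 * n) n := by
    rw [mem_singletSector_iff, h2n, sub_self, zero_div]
    exact ⟨hψK, hP⟩
  refine Model.singletEnergy_eq_energy_of_singlet_witness hF hnk hψS h0 (le_of_eq ?_)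
  rw [hubbardRingTV_hamiltonian_eq, hHψ, dotProduct_smul, smul_eq_mul, Complex.re_ofReal_mul,
    groundEnergyAt_eq_minEnergyOn_szSector (ringGraph (2 * n)) _ _ (by rw [Fintype.card_fin]; omega),
    Model.energy, sectorGroundEnergy_def, hubbardRingTV_hamiltonian_eq, h2n, sub_self, zero_div]

/-- The literal instances used by `Certificates/`: `L = 4`, sector `(2,2)`, `t = 1`, any `U > 0`. -/
theorem hubbardRingTV_four_singletEnergy_eq {U : ℚ} (hU : 0 < U) :
    (hubbardRingTV 4 1 U).singletEnergy 2 = (hubbardRingTV 4 1 U).energy 2 2 :=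
  hubbardRingTV_singletEnergy_eq_energy (n := 2) (by norm_num) one_ne_zero hU

/-- The literal instances used by `Certificates/`: `L = 6`, sector `(3,3)`, `t = 1`, any `U > 0`. -/
theorem hubbardRingTV_six_singletEnergy_eq {U : ℚ} (hU : 0 < U) :
    (hubbardRingTV 6 1 U).singletEnergy 3 = (hubbardRingTV 6 1 U).energy 3 3 :=
  hubbardRingTV_singletEnergy_eq_energy (n := 3) (by norm_num) one_ne_zero hU

/-- Row transport on the even half-filled repulsive rings: a SINGLET lower row is a SECTOR lower row. -/
theorem SingletLowerRow.lowerRow_hubbardRingTV {n : ℕ} (hn : 0 < n) {t U : ℚ} (ht : t ≠ 0)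
    (hU : 0 < U) {lo : ℚ} (h : SingletLowerRow (hubbardRingTV (2 * n) t U) n lo) :
    LowerRow (hubbardRingTV (2 * n) t U) n n lo :=
  h.lowerRow_of_eq (hubbardRingTV_singletEnergy_eq_energy hn ht hU)

/-- … and a SECTOR upper row is a SINGLET upper row. -/
theorem UpperRow.singletUpperRow_hubbardRingTV {n : ℕ} (hn : 0 < n) {t U : ℚ} (ht : t ≠ 0)
    (hU : 0 < U) {hi : ℚ} (h : UpperRow (hubbardRingTV (2 * n) t U) n n hi) :
    SingletUpperRow (hubbardRingTV (2 * n) t U) n hi :=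
  h.singletUpperRow_of_eq (hubbardRingTV_singletEnergy_eq_energy hn ht hU)

end Summit.Ventures.CertifiedQuantumChemistry

end
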